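import Literature.NumberTheory.Automorphic.Liu2021.LemD1AsPrinted
import Literature.RepresentationTheory.IrreducibleTwistTransport
import Literature.RepresentationTheory.SeesawScalarCharacter
import HarnessLib

/-!
# [Liu2021, App. D, Lemma D.1] first sentence + (1): invariance under a twist of `ω(μ, ε)` by a character of `U(V)(F)`

Topic `NumberTheory/Automorphic/Liu2021`; KERNEL ONLY (one data-valued definition `LemD1Data.twist`, theorems; no named
fact, no `def … : Prop`, no `sorry`).  Companion of the statement-exact record `Liu2021/LemD1AsPrinted.lean`
(`LemD1Data`, `LemD1_1AsPrinted`); nothing of [Liu2021] is asserted here.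

## What is proved, and why

The datum `L : LemD1Data F E n V` of [Liu2021, App. D §D.1] posits ONE carrier: the representation
`L.omega = ω(μ, ε) = ω(ε) ∘ ι_μ` of `U(V)(F) = L.S.U` on `V` (Steps 1–2, `FJcycle.tex` l. 5217–5219), the oscillator
representation of `Mp(V_ε)` pulled back along the splitting `ι_μ` of [HarrisKudlaSweet1996, §1].  A consumer instantiates
`omega` with ITS OWN splitting of the metaplectic cover over `U(V)(F)` (in the Hodge/COR-CM cell: the tree's
`LocalSplittingDatum.localOmega`, Kudla's `β` and a Leray-normalised implementer section,
`GelbartRogawski1991/LocalUnitarySplittingDatum.lean`); two splittings of the same cover over the same group differ by a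
character `η : U(V)(F) → ℂ^×` with values in the centre ([GelbartRogawski1991, §3.1 Remark p. 457 L4–13];
[MoeglinVignerasWaldspurger1987, Chap. 2 II.1]), so the two candidate carriers are `ω` and the twist
`η • ω : g ↦ η(g) ω(g)` (the tree's `SeesawScalar.twist η ω`).  This file proves that the CONTENT of Lemma D.1, first
sentence and item (1), does not see such a twist:

* `LemD1Data.twist L η …` — the datum with `omega := η • ω` and Step 3's character moved accordingly,
  `chi := χ · (η ∘ scalar)` (for `z ∈ E^1 ↪ U(V)` central, `(η • ω)(z) v − (χ η)(z) v = η(z) • (ω(z) v − χ(z) v)`), all other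
  fields (the local field, `S`, `ε`, `μ`) unchanged; it is a datum again as soon as `η ∘ scalar` is unitary and
  continuous (`‖η(z·1)‖ = 1`, the printed «`χ : E^1 → ℂ^1`»);
* `LemD1Data.augmentation_twist` — the relation submodules of the two maximal quotients COINCIDE, so
  `ω(μ, ε, χ)` and its twisted counterpart live on canonically isomorphic spaces (`LemD1Data.twistQuotEquiv`, `mk ↦ mk`)
  with actions differing by `η(g)` (`twistQuotEquiv_quot`);
* generic transport (namespace `Representation`, any field `k`, any topological group with continuous multiplication):
  along a linear equivalence `e` with `e (ρ g v) = η(g) • ρ' g (e v)` and `ker η` OPEN, smoothness and admissibility pass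
  from `ρ` to `ρ'` (`IsSmooth.of_twist_equivariant`, `IsAdmissible.of_twist_equivariant`: the stabiliser of `e v` contains
  `Stab_ρ(v) ∩ ker η`; `V'^K ⊆ e(V^{K ∩ ker η})` and `K ∩ ker η` is compact open), and «irreducible-or-zero» is invariant
  (`isIrreducibleOrZero_iff_of_twist_equivariant`, from the tree's order isomorphism of stable subspaces
  `Representation.exists_orderIso_subrepresentation_of_twist`, [Bump1997, §4.2]);
* `LemD1Data.firstSentence_twist_iff` — «`ω(μ, ε, χ)` is irreducible and admissible» holds for `L.twist η` iff it holds for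
  `L`, for EVERY rank `n` (READINGS I1/I2′ of the record), whenever `ker η` is open;
* `LemD1_1AsPrinted.twist_iff` — for `n ≠ 2` the whole record (first sentence + item (1)) is twist-invariant: the space of
  `ω(μ, ε, χ)` is the same, and the printed right-hand side of (1) contains «`n = 2`», false on both sides.  (At `n = 2`
  the clause «`χ̌ = μ²`» of (1) is NOT twist-invariant — it distinguishes `χ` from `χ η` — and no such statement is claimed.)
* plumbing: `OscillatorStandingData.continuous_scalar` (the centre `E^1 ↪ U(V)(F)` is continuous) and
  `LemD1Data.continuous_eta_scalar_of_isOpen_ker` (an open-kernel `η` is continuous on the centre — supplies the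
  continuity hypothesis of `twist` when `E` is a topological ring).

Use (Hodge/COR-CM cell, rank `n = 3`): the per-place cite `hD1` of the END display
(`Summits/HodgeConjecture/CorCM/B01/Transposition/…RestOneBuiltEpiD1.lean`) reads Lemma D.1 (1) AS PRINTED at a datum whose
`omega` is the tree's constructed local Weil representation for ONE normalisation of the splitting; by `twist_iff` its
truth there for all unitary continuous `χ` is the same as for any other normalisation differing by an open-kernel
character `η` unitary on the centre (`χ ↦ χ · (η ∘ scalar)` permutes the unitary continuous characters of `E^1`) — the
residual object-match duty (om1) of `LemD1AsPrinted.lean` is insensitive to the normalisation of `ι_μ` at rank `≠ 2`.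
HC_CM is not touched: nothing here is a hypothesis or a discharge of the END display.

## References
* [Liu2021] Y. Liu, *Fourier–Jacobi cycles and arithmetic relative trace formula*, Camb. J. Math. 9 (2021) =
  arXiv:2102.11518, App. D §D.1 Steps 1–3 (l. 5215–5222; footnote l. 5217 «the resulting oscillator representation depends
  only on `ε`»), Lemma D.1 (l. 5226–5229).
* [GelbartRogawski1991] S. Gelbart, J. Rogawski, Invent. Math. 105 (1991), §3.1 Remark p. 457 L4–13 (two splittings differ
  by a central character).
* [HarrisKudlaSweet1996] M. Harris, S. S. Kudla, W. J. Sweet, J. Amer. Math. Soc. 9 (1996), §1 (the splittings `ι_μ`).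
* [MoeglinVignerasWaldspurger1987] C. Mœglin, M.-F. Vignéras, J.-L. Waldspurger, LNM 1291 (1987), Chap. 2 II.1 (the
  metaplectic group of pairs; its centre `ℂ^×`).
* [Bump1997] D. Bump, *Automorphic forms and representations*, CUP 1997, §4.2 p. 423–425 (smooth/admissible; twisting by a
  character).
* [BernsteinZelevinsky1976] I. N. Bernstein, A. V. Zelevinsky, Russian Math. Surveys 31 (1976), Def. 2.1 (smooth,
  admissible; characters with open kernel).
-/

noncomputable section

/-! ## §1 Generic transport of smoothness / admissibility / «irreducible or zero» along a twisted-equivariant equivalence -/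

namespace Representation

variable {k G V V' : Type*} [Field k] [Group G] [AddCommGroup V] [Module k V] [AddCommGroup V'] [Module k V']
  (ρ : Representation k G V) (ρ' : Representation k G V') (e : V ≃ₗ[k] V') (η : G →* kˣ)

/-- The symmetric form of the twisted intertwining law: from `e (ρ g v) = η(g) • ρ' g (e v)` one gets
`e⁻¹ (ρ' g v') = η(g)⁻¹ • ρ g (e⁻¹ v')`. [folklore] -/
private theorem twist_equivariant_symm (he : ∀ g v, e (ρ g v) = (η g : k) • ρ' g (e v)) (g : G) (v' : V') :
    e.symm (ρ' g v') = ((η⁻¹ : G →* kˣ) g : k) • ρ g (e.symm v') := by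
  apply e.injective
  rw [LinearEquiv.map_smul, he, e.apply_symm_apply, e.apply_symm_apply, smul_smul, MonoidHom.inv_apply,
    Units.inv_mul, one_smul]

omit [Field k] in
/-- The kernel of `η⁻¹` is the kernel of `η`. [folklore] -/
private theorem ker_inv_eq_ker {k : Type*} [CommGroup k] (η : G →* k) : (η⁻¹ : G →* k).ker = η.ker := by
  ext g
  rw [MonoidHom.mem_ker, MonoidHom.mem_ker, MonoidHom.inv_apply, inv_eq_one]

/-- Under `e (ρ g v) = η(g) • ρ' g (e v)`: an element fixing `v` under `ρ` and killed by `η` fixes `e v` under `ρ'`.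
[cite: Bump1997, §4.2 (twisting a representation by a character)] -/
theorem stabilizerSubgroup_inf_ker_le_of_twist (he : ∀ g v, e (ρ g v) = (η g : k) • ρ' g (e v)) (v : V) :
    ρ.stabilizerSubgroup v ⊓ η.ker ≤ ρ'.stabilizerSubgroup (e v) := by
  intro g hg
  obtain ⟨h1, h2⟩ := Subgroup.mem_inf.1 hg
  rw [mem_stabilizerSubgroup] at h1 ⊢
  rw [MonoidHom.mem_ker] at h2
  have h := he g v
  rw [h1, h2, Units.val_one, one_smul] at h
  exact h.symm

/-- Under `e (ρ g v) = η(g) • ρ' g (e v)`: the `K`-fixed vectors of `ρ'` come from the `(K ∩ ker η)`-fixed vectors of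
`ρ`, `V'^K ≤ e (V^{K ⊓ ker η})`. [cite: Bump1997, §4.2 (twisting a representation by a character)] -/
theorem fixedPoints_le_map_of_twist (he : ∀ g v, e (ρ g v) = (η g : k) • ρ' g (e v)) (K : Subgroup G) :
    ρ'.fixedPoints K ≤ (ρ.fixedPoints (K ⊓ η.ker)).map (e : V →ₗ[k] V') := by
  intro v' hv'
  rw [mem_fixedPoints] at hv'
  refine ⟨e.symm v', ?_, e.apply_symm_apply v'⟩
  rw [SetLike.mem_coe, mem_fixedPoints]
  intro g hg
  obtain ⟨hgK, hgη⟩ := Subgroup.mem_inf.1 hg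
  rw [MonoidHom.mem_ker] at hgη
  apply e.injective
  rw [he, e.apply_symm_apply, hv' g hgK, hgη, Units.val_one, one_smul]

variable [TopologicalSpace G] [ContinuousMul G]

variable {ρ} in
/-- **Smoothness passes along a twisted-equivariant linear equivalence when the twisting character has open
kernel**: `Stab_{ρ'}(e v) ⊇ Stab_ρ(v) ∩ ker η` is open. [cite: BernsteinZelevinsky1976, Definition 2.1] -/
theorem IsSmooth.of_twist_equivariant (hη : IsOpen (η.ker : Set G))
    (he : ∀ g v, e (ρ g v) = (η g : k) • ρ' g (e v)) (h : ρ.IsSmooth) : ρ'.IsSmooth := by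
  intro v'
  obtain ⟨v, rfl⟩ := e.surjective v'
  rw [isSmoothVector_iff]
  refine Subgroup.isOpen_mono (stabilizerSubgroup_inf_ker_le_of_twist ρ ρ' e η he v) ?_
  rw [Subgroup.coe_inf]
  exact (h v).inter hη

variable {ρ} in
/-- **Admissibility passes along a twisted-equivariant linear equivalence when the twisting character has open
kernel**: for a compact open `K`, `K ∩ ker η` is compact open and `V'^K ≤ e (V^{K ∩ ker η})` is finite-dimensional.
[cite: BernsteinZelevinsky1976, Definition 2.1(b)] -/
theorem IsAdmissible.of_twist_equivariant (hη : IsOpen (η.ker : Set G))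
    (he : ∀ g v, e (ρ g v) = (η g : k) • ρ' g (e v)) (h : ρ.IsAdmissible) : ρ'.IsAdmissible := by
  refine ⟨h.isSmooth.of_twist_equivariant ρ' e η hη he, fun K hK => ?_⟩
  let K' : OpenSubgroup G := ⟨(K : Subgroup G) ⊓ η.ker, K.isOpen.inter hη⟩
  have hK' : IsCompact (K' : Set G) := hK.inter_right (Subgroup.isClosed_of_isOpen _ hη)
  haveI := h.finite_fixedPoints K' hK'
  haveI : Module.Finite k ((ρ.fixedPoints ((K : Subgroup G) ⊓ η.ker)).map (e : V →ₗ[k] V')) :=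
    Module.Finite.map _ _
  exact Submodule.finiteDimensional_of_le (fixedPoints_le_map_of_twist ρ ρ' e η he (K : Subgroup G))

/-- … hence smoothness is INVARIANT under such a twist. [cite: BernsteinZelevinsky1976, Definition 2.1] -/
theorem isSmooth_iff_of_twist_equivariant (hη : IsOpen (η.ker : Set G))
    (he : ∀ g v, e (ρ g v) = (η g : k) • ρ' g (e v)) : ρ.IsSmooth ↔ ρ'.IsSmooth :=
  ⟨IsSmooth.of_twist_equivariant ρ' e η hη he,
    IsSmooth.of_twist_equivariant ρ e.symm η⁻¹ (by rw [ker_inv_eq_ker]; exact hη)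
      (twist_equivariant_symm ρ ρ' e η he)⟩

/-- … and admissibility is INVARIANT under such a twist. [cite: BernsteinZelevinsky1976, Definition 2.1(b)] -/
theorem isAdmissible_iff_of_twist_equivariant (hη : IsOpen (η.ker : Set G))
    (he : ∀ g v, e (ρ g v) = (η g : k) • ρ' g (e v)) : ρ.IsAdmissible ↔ ρ'.IsAdmissible :=
  ⟨IsAdmissible.of_twist_equivariant ρ' e η hη he,
    IsAdmissible.of_twist_equivariant ρ e.symm η⁻¹ (by rw [ker_inv_eq_ker]; exact hη)
      (twist_equivariant_symm ρ ρ' e η he)⟩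

end Representation

namespace Literature.NumberTheory.Automorphic.Liu2021

open Literature.RepresentationTheory (SeesawScalar.twist SeesawScalar.twist_apply)
open Literature.RepresentationTheory.CentralCharacterQuotient (augmentation quotRep quotRep_mk)

/-- **«irreducible (or zero)» (READING I1 of `Def411AsPrinted`) is invariant under a twisted-equivariant linear
equivalence** `e (ρ g v) = η(g) • ρ' g (e v)`: the `ρ`-stable and the `ρ'`-stable subspaces correspond under `e`
(tree `Representation.exists_orderIso_subrepresentation_of_twist`), and an order isomorphism preserves `⊥` and `⊤`.
[cite: Bump1997, §4.2 (twisting a representation by a character)] -/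
theorem isIrreducibleOrZero_iff_of_twist_equivariant {G V V' : Type} [Group G] [AddCommGroup V] [Module ℂ V]
    [AddCommGroup V'] [Module ℂ V'] (ρ : Representation ℂ G V) (ρ' : Representation ℂ G V') (e : V ≃ₗ[ℂ] V')
    (η : G →* ℂˣ) (he : ∀ g v, e (ρ g v) = (η g : ℂ) • ρ' g (e v)) :
    IsIrreducibleOrZero ρ ↔ IsIrreducibleOrZero ρ' := by
  obtain ⟨Φ, -⟩ := Representation.exists_orderIso_subrepresentation_of_twist ρ ρ' (MonoidHom.id G)
    Function.surjective_id e (fun g => η g) fun g v => he g v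
  constructor
  · intro h W'
    rcases h (Φ.symm W') with hW | hW
    · left
      rw [← Φ.apply_symm_apply W', hW, Φ.map_bot]
    · right
      rw [← Φ.apply_symm_apply W', hW, Φ.map_top]
  · intro h W
    rcases h (Φ W) with hW | hW
    · left
      rw [← Φ.symm_apply_apply W, hW, Φ.symm.map_bot]
    · right
      rw [← Φ.symm_apply_apply W, hW, Φ.symm.map_top]

/-! ## §2 The twisted datum of [Liu2021, App. D §D.1] -/

variable {F E : Type} [Field F] [ValuativeRel F] [TopologicalSpace F] [CommRing E] [Algebra F E]
  [TopologicalSpace E] {n : ℕ} {V : Type} [AddCommGroup V] [Module ℂ V]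

omit [ValuativeRel F] [TopologicalSpace F] in
/-- The centre `E^1 ↪ U(V)(F)`, `x ↦ x · 1`, is continuous for the topologies inherited from `E`
(`E^1 ≤ E^×`, `U(V)(F) ≤ GL_n(E)`). [cite: Liu2021, App. D §D.1 Step 3 (l. 5221)] -/
theorem _root_.Literature.RepresentationTheory.Liu2021.OscillatorStandingData.continuous_scalar
    (S : Literature.RepresentationTheory.Liu2021.OscillatorStandingData F E n) : Continuous S.scalar := by
  have hsc : Continuous fun x : E => Matrix.scalar (Fin n) x :=
    (continuous_pi fun _ => continuous_id).matrix_diagonal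
  have hu : Continuous (Literature.RepresentationTheory.Liu2021.OscillatorStandingData.unitScalar (E := E) n) :=
    Continuous.units_map _ hsc
  exact Continuous.subtype_mk (hu.comp continuous_subtype_val) _

namespace LemD1Data

variable (L : LemD1Data F E n V) (η : L.S.U →* ℂˣ)
  (hηn : ∀ z : L.S.normOne, ‖((η (L.S.scalar z) : ℂˣ) : ℂ)‖ = 1)
  (hηc : Continuous fun z : L.S.normOne => ((η (L.S.scalar z) : ℂˣ) : ℂ))

/-- **A character of `U(V)(F)` with OPEN kernel is continuous on the centre `E^1`** (`E` a topological ring): its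
restriction `η ∘ scalar` has open kernel (`continuous_scalar`), so it is locally constant, and a homomorphism out of a
topological group that is continuous at `1` is continuous (a character with open kernel is smooth,
[BernsteinZelevinsky1976, §2.1]).  Supplies the hypothesis `hηc` of `LemD1Data.twist` in the model case (two smooth
splittings differ by a character trivial on an open subgroup). [cite: BernsteinZelevinsky1976, §2.1] -/
theorem continuous_eta_scalar_of_isOpen_ker [IsTopologicalRing E]
    (hker : IsOpen ((η.ker : Subgroup L.S.U) : Set L.S.U)) :
    Continuous fun z : L.S.normOne => ((η (L.S.scalar z) : ℂˣ) : ℂ) := by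
  have hθ : IsOpen (((η.comp L.S.scalar).ker : Subgroup L.S.normOne) : Set L.S.normOne) := by
    rw [← MonoidHom.comap_ker, Subgroup.coe_comap]
    exact hker.preimage L.S.continuous_scalar
  have hc : Continuous (η.comp L.S.scalar) :=
    continuous_of_continuousAt_one (η.comp L.S.scalar)
      ((continuousAt_const : ContinuousAt (fun _ : L.S.normOne => (1 : ℂˣ)) 1).congr_of_eventuallyEq
        (Filter.eventually_of_mem (hθ.mem_nhds (one_mem _)) fun z hz => (MonoidHom.mem_ker).1 hz))
  exact Units.continuous_val.comp hc

/-- **The twisted datum.**  Same local field, same standing data `S` (so the same `U(V)(F)`, `E^1`, `c`, `( , )_V`),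
same `ε` (Step 1) and `μ` (Step 2); the ⟨CARRIER⟩ becomes the twist `η • ω(μ, ε) : g ↦ η(g) ω(μ, ε)(g)`
(`SeesawScalar.twist η L.omega`) by a character `η` of `U(V)(F)`, and Step 3's character becomes `χ · (η ∘ scalar)` on
`E^1` — again with values in `ℂ^1` and continuous by the hypotheses `hηn`, `hηc` on `η` restricted to the centre
`E^1 ↪ U(V)(F)`.  (Model case: `ω` and `η • ω` are the oscillator representation pulled back along two splittings of the
metaplectic cover over `U(V)(F)`, which differ by the central character `η`.)
[cite: GelbartRogawski1991, §3.1 Remark p. 457 L4–13] [cite: Liu2021, App. D §D.1 Steps 1–3 (l. 5215–5222)] -/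
def twist : LemD1Data F E n V :=
  { L with
    chi := L.chi * η.comp L.S.scalar
    norm_chi := fun z => by
      rw [MonoidHom.mul_apply, Units.val_mul, norm_mul, L.norm_chi z, one_mul, MonoidHom.comp_apply]
      exact hηn z
    continuous_chi := by
      have h : (fun z : L.S.normOne => ((((L.chi * η.comp L.S.scalar) z : ℂˣ)) : ℂ)) =
          fun z => ((L.chi z : ℂˣ) : ℂ) * ((η (L.S.scalar z) : ℂˣ) : ℂ) := by
        funext z
        rw [MonoidHom.mul_apply, Units.val_mul, MonoidHom.comp_apply]
      rw [h]
      exact L.continuous_chi.mul hηc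
    omega := SeesawScalar.twist η L.omega }

/-- The standing data are unchanged by the twist. [cite: Liu2021, App. D §D.1 (l. 5213)] -/
@[simp] theorem twist_S : (L.twist η hηn hηc).S = L.S := rfl

/-- `ε` is unchanged by the twist. [cite: Liu2021, App. D §D.1 Step 1] -/
@[simp] theorem twist_eps : (L.twist η hηn hηc).eps = L.eps := rfl

/-- `μ` is unchanged by the twist. [cite: Liu2021, App. D §D.1 Step 2] -/
@[simp] theorem twist_mu : (L.twist η hηn hηc).mu = L.mu := rfl

/-- Step 3's character of the twisted datum is `χ · (η ∘ scalar)`. [cite: Liu2021, App. D §D.1 Step 3] -/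
@[simp] theorem twist_chi : (L.twist η hηn hηc).chi = L.chi * η.comp L.S.scalar := rfl

/-- The carrier of the twisted datum is `η • ω`. [cite: GelbartRogawski1991, §3.1 Remark p. 457 L4–13] -/
@[simp] theorem twist_omega : (L.twist η hηn hηc).omega = SeesawScalar.twist η L.omega := rfl

/-- «`V` is anisotropic» does not see the twist (it is a property of `S`). [cite: Liu2021, App. D Lemma D.1 (1)] -/
theorem twist_isAnisotropic_iff : (L.twist η hηn hηc).IsAnisotropic ↔ L.IsAnisotropic := Iff.rfl

omit [ValuativeRel F] [TopologicalSpace F] [TopologicalSpace E] in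
/-- **The relation submodules coincide**: for central `z ∈ E^1`,
`(η • ω)(z) − (χ η)(z) • id = η(z) • (ω(z) − χ(z) • id)` has the same range as `ω(z) − χ(z) • id`, so
`augmentation (η • ω) scalar (χ · η∘scalar) = augmentation ω scalar χ`. [cite: Liu2021, App. D §D.1 Step 3 (l. 5221)] -/
theorem augmentation_twist (S : Literature.RepresentationTheory.Liu2021.OscillatorStandingData F E n)
    (ω : Representation ℂ S.U V) (χ : S.normOne →* ℂˣ) (η : S.U →* ℂˣ) :
    augmentation (SeesawScalar.twist η ω) S.scalar (χ * η.comp S.scalar) = augmentation ω S.scalar χ := by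
  unfold augmentation
  refine iSup_congr fun z => ?_
  have hmap : SeesawScalar.twist η ω (S.scalar z) - (((χ * η.comp S.scalar) z : ℂˣ) : ℂ) • LinearMap.id =
      ((η (S.scalar z) : ℂˣ) : ℂ) • (ω (S.scalar z) - ((χ z : ℂˣ) : ℂ) • (LinearMap.id : V →ₗ[ℂ] V)) := by
    ext v
    simp only [LinearMap.sub_apply, LinearMap.smul_apply, LinearMap.id_coe, id_eq, SeesawScalar.twist_apply,
      MonoidHom.mul_apply, MonoidHom.comp_apply, Units.val_mul, smul_sub, smul_smul, mul_comm]
  rw [hmap, LinearMap.range_smul _ _ (Units.ne_zero _)]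

/-- **The spaces of `ω(μ, ε, χ)` for `L` and for its twist are canonically isomorphic** (`mk v ↦ mk v`, the two
relation submodules being equal). [cite: Liu2021, App. D §D.1 Step 3 (l. 5221)] -/
def twistQuotEquiv :
    (V ⧸ augmentation (L.twist η hηn hηc).omega (L.twist η hηn hηc).S.scalar (L.twist η hηn hηc).chi) ≃ₗ[ℂ]
      (V ⧸ augmentation L.omega L.S.scalar L.chi) :=
  Submodule.quotEquivOfEq _ _ (augmentation_twist L.S L.omega L.chi η)

/-- `twistQuotEquiv (mk v) = mk v`. [cite: Liu2021, App. D §D.1 Step 3 (l. 5221)] -/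
@[simp] theorem twistQuotEquiv_mk (v : V) :
    L.twistQuotEquiv η hηn hηc (Submodule.Quotient.mk v) = Submodule.Quotient.mk v :=
  Submodule.quotEquivOfEq_mk _ _ _ v

/-- **The two actions differ by `η`**: `twistQuotEquiv ((η • ω)(μ, ε, χη)(g) w) = η(g) • ω(μ, ε, χ)(g) (twistQuotEquiv w)`.
[cite: GelbartRogawski1991, §3.1 Remark p. 457 L4–13] -/
theorem twistQuotEquiv_quot (g : L.S.U)
    (w : V ⧸ augmentation (L.twist η hηn hηc).omega (L.twist η hηn hηc).S.scalar (L.twist η hηn hηc).chi) :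
    L.twistQuotEquiv η hηn hηc ((L.twist η hηn hηc).datum.quot g w) =
      ((η g : ℂˣ) : ℂ) • L.datum.quot g (L.twistQuotEquiv η hηn hηc w) := by
  obtain ⟨v, rfl⟩ := Submodule.mkQ_surjective _ w
  -- both sides are `mk (η(g) • ω(g) v)` in `V ⧸ augmentation ω scalar χ` (`quotEquivOfEq (mk v) = mk v` definitionally)
  change (Submodule.Quotient.mk ((((η g : ℂˣ) : ℂ)) • L.omega g v) : V ⧸ augmentation L.omega L.S.scalar L.chi) =
    ((η g : ℂˣ) : ℂ) • (Submodule.Quotient.mk (L.omega g v) : V ⧸ augmentation L.omega L.S.scalar L.chi)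
  exact Submodule.Quotient.mk_smul _ _ _

/-! ## §3 The first sentence of Lemma D.1 is twist-invariant (every rank) -/

/-- **«`ω(μ, ε, χ)` is irreducible and admissible» is twist-invariant**: for a character `η` of `U(V)(F)` with OPEN
kernel, the first sentence of [Liu2021, Lem. D.1] (READINGS I1, I2′) holds for the twisted datum iff it holds for `L` —
any rank `n ≥ 2`. [cite: Liu2021, App. D Lemma D.1 (l. 5227)] [cite: Bump1997, §4.2] -/
theorem firstSentence_twist_iff [IsTopologicalRing E] (hker : IsOpen ((η.ker : Subgroup L.S.U) : Set L.S.U)) :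
    (IsIrreducibleOrZero (L.twist η hηn hηc).datum.quot ∧ (L.twist η hηn hηc).datum.quot.IsAdmissible) ↔
      (IsIrreducibleOrZero L.datum.quot ∧ L.datum.quot.IsAdmissible) :=
  and_congr
    (isIrreducibleOrZero_iff_of_twist_equivariant _ _ (L.twistQuotEquiv η hηn hηc) η
      (L.twistQuotEquiv_quot η hηn hηc))
    (Representation.isAdmissible_iff_of_twist_equivariant _ _ (L.twistQuotEquiv η hηn hηc) η hker
      (L.twistQuotEquiv_quot η hηn hηc))

/-- The zero-space clause of item (1) is twist-invariant (same space). [cite: Liu2021, App. D Lemma D.1 (1)] -/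
theorem subsingleton_twist_iff :
    Subsingleton (V ⧸ augmentation (L.twist η hηn hηc).omega (L.twist η hηn hηc).S.scalar (L.twist η hηn hηc).chi) ↔
      Subsingleton (V ⧸ augmentation L.omega L.S.scalar L.chi) :=
  (L.twistQuotEquiv η hηn hηc).toEquiv.subsingleton_congr

end LemD1Data

/-! ## §4 Lemma D.1, first sentence + (1), AS PRINTED, is twist-invariant for `n ≠ 2` -/

/-- **[Liu2021, App. D, Lemma D.1, first sentence + (1)] AS PRINTED is invariant under twisting `ω(μ, ε)` by an
open-kernel character of `U(V)(F)` unitary and continuous on the centre, for rank `n ≠ 2`.**  The first sentence by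
`LemD1Data.firstSentence_twist_iff`; in item (1) the space of `ω(μ, ε, χ)` is the same for both data and the printed
right-hand side «`E` is a field, `V` is anisotropic (in particular `n = 2`), and `χ̌ = μ²`» is false for both when
`n ≠ 2`.  (For `n = 2` the clause `χ̌ = μ²` distinguishes `χ` from `χ η`; nothing is claimed there.)  So a consumer of
the record at rank `n ≥ 3` may read it at EITHER normalisation of the splitting `ι_μ`.
[cite: Liu2021, App. D Lemma D.1 (l. 5227–5229)] [cite: GelbartRogawski1991, §3.1 Remark p. 457 L4–13] -/
theorem LemD1_1AsPrinted.twist_iff [IsTopologicalRing E] (L : LemD1Data F E n V) (η : L.S.U →* ℂˣ)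
    (hηn : ∀ z : L.S.normOne, ‖((η (L.S.scalar z) : ℂˣ) : ℂ)‖ = 1)
    (hηc : Continuous fun z : L.S.normOne => ((η (L.S.scalar z) : ℂˣ) : ℂ))
    (hker : IsOpen ((η.ker : Subgroup L.S.U) : Set L.S.U)) (hn : n ≠ 2) :
    LemD1_1AsPrinted (L.twist η hηn hηc) ↔ LemD1_1AsPrinted L := by
  refine and_congr (L.firstSentence_twist_iff η hηn hηc hker) ?_
  rw [L.subsingleton_twist_iff η hηn hηc]
  constructor
  · intro h
    exact ⟨fun hs => absurd (h.1 hs).2.1.2 hn, fun hr => absurd hr.2.1.2 hn⟩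
  · intro h
    exact ⟨fun hs => absurd (h.1 hs).2.1.2 hn, fun hr => absurd hr.2.1.2 hn⟩

/-- Consumer form: Lemma D.1 (first sentence + (1)) AS PRINTED at `L` gives it at every admissible twist of `L`, rank
`n ≠ 2`. [cite: Liu2021, App. D Lemma D.1 (l. 5227–5229)] -/
theorem LemD1_1AsPrinted.twist [IsTopologicalRing E] {L : LemD1Data F E n V} (h : LemD1_1AsPrinted L)
    (η : L.S.U →* ℂˣ) (hηn : ∀ z : L.S.normOne, ‖((η (L.S.scalar z) : ℂˣ) : ℂ)‖ = 1)
    (hηc : Continuous fun z : L.S.normOne => ((η (L.S.scalar z) : ℂˣ) : ℂ))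
    (hker : IsOpen ((η.ker : Subgroup L.S.U) : Set L.S.U)) (hn : n ≠ 2) :
    LemD1_1AsPrinted (L.twist η hηn hηc) :=
  (LemD1_1AsPrinted.twist_iff L η hηn hηc hker hn).2 h

end Literature.NumberTheory.Automorphic.Liu2021

end
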